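import Summits.BirchSwinnertonDyer.BirchSwinnertonDyer.Theses.ShaPrimaryTransfer
import Literature.NumberTheory.EllipticCurves.XCubeSub8XSqAddXSha
import HarnessLib

/-!
# Route ShaPrimaryTransfer — THE ISOGENY DOOR: `t_2(X) = 0` certified for `X : y² = x³ − 8x² + x` although
# `Ш(X/ℚ)[2] ≠ 0` (a finite, non-trivial `Ш[2^∞]`), and what this says about the crux T

Helper for item stmt-BirchSwinnertonDyer-22356 (`FiniteShaComponentTransfer`, «T»; conjecture-grade at rank
`≥ 2`, unchanged) of route `route-BirchSwinnertonDyer-ShaPrimaryTransfer`. BSD is NOT proved by any of this;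
T is not proved by any of this; no beyond-print theorem is claimed (the method is Silverman, *AEC* X.4.9 /
X.6.5; the curve is a routine example).

T says `t_p(E) = corank_{ℤ_p} Ш(E/ℚ)[p^∞] = 0` at one prime forces `t_q(E) = 0` at every prime; the route's
DOOR is «complete `p₀`-descent decides `t_{p₀}(E) = 0` curve by curve». Every cell of the cross-prime table so far
(g8–g10, `…CrossPrimeCell*`) is a SHARP descent on the carrier itself: `Ш(E)[p₀] = 0`. This file records the
first cell of the SECOND KIND, from the Literature files `XCubeSub8XSqAddX{RankZero, Selmer, Sha}` (this seat):

  `X = [0, −8, 0, 1, 0] : y² = x³ − 8x² + x`,  `X' = X/⟨(0,0)⟩ : y² = x(x + 6)(x + 10)`,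
  `Y = [0, −2, 0, −24, 0] : y² = x(x − 6)(x + 4) ≅ X'`,  `X ~ Y` over `ℚ`.

* **The door at `2` is CLOSED on `X` at the first descent but OPEN on the isogenous `Y`**
  (`door_closed_on_X_open_on_Y`): `Ш(X/ℚ)[2] ≠ 0` — indeed `#Ш(X/ℚ)[φ] = 4`, all sixteen classes of
  `S^{(φ)}(X/ℚ) = S(16, 60)` being everywhere locally soluble while only four come from `X'(ℚ)` — whereas the
  descent on `Y` is sharp (`Ш(Y/ℚ)[2] = 0`, `rank = 0`); so `t_2(X) = t_2(Y) = 0` by the isogeny invariance of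
  `t_p` (`…Isogeny` §2 of g3, here exercised on a curve with `Ш(X)[2] ≠ 0`: `XCubeSub8XSqAddX.shaCorank_X_two`).
* **`Ш(X/ℚ)[2^∞]` is FINITE and NON-ZERO** (`finite_nonzero_sha_two_primary_X`): the first Tate–Shafarevich
  primary component in the tree certified to be both; T's currency `t_p` does not see it (`t_2(X) = 0`), which is
  exactly why T is stated with coranks: the finite-level reading «`Ш(E)[p] ≠ 0 ⟹ t_p(E) > 0`» is FALSE
  (`not_sha_two_torsion_detects_corank`), and `Ш[p] = 0` is not an isogeny invariant although `t_p = 0` is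
  (`sha_two_torsion_not_isogeny_invariant'`).
* **T on `X`** (`transfer_predicts_X`): the door datum `t_2(X) = 0` is unconditional, so T predicts `t_q(X) = 0`
  for every prime `q` — at rank `0` this is «`Ш(X/ℚ)` is finite», known here only for the `2`-part; O's instance
  on `X` holds with the witness prime `2` DESPITE `Ш(X)[2] ≠ 0` (`oneFiniteShaComponent_X`).
* The Selmer column (`selmer_column_X`): `corank_{ℤ₂} Sel_{2^∞}(X/ℚ) = 0 = rank X(ℚ)` while
  `dim₂ S^{(φ)}(X/ℚ) = 4`: the `2^∞`-Selmer CORANK, not the `2`-Selmer RANK, is T's bookkeeping.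

References: J. H. Silverman, *AEC*, Prop. X.4.9, Thm. X.4.2(a), Prop. X.6.5(b); R. Greenberg, LNM 1716, §1;
J. W. S. Cassels, *Arithmetic on curves of genus 1, VIII*, Crelle 217 (1965) (`Ш[p]` moves under isogeny).
-/

-- D-0017: single-problem summit, so `Summit.BirchSwinnertonDyer.BirchSwinnertonDyer.…` repeats a namespace BY DESIGN.
set_option linter.dupNamespace false

noncomputable section

namespace Summit.BirchSwinnertonDyer.BirchSwinnertonDyer.Theorems.ShaPrimaryTransferIsogenyDoor

open scoped Classical
open Summit.BirchSwinnertonDyer.BirchSwinnertonDyer.Theses.ShaPrimaryTransfer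
  (FiniteShaComponentTransfer OneFiniteShaComponent)
open Literature.NumberTheory.EllipticCurves Literature.NumberTheory.EllipticCurves.XCubeSub8XSqAddX
open WeierstrassCurve

/-! ## §1 The door at `2`: closed on `X` at the first descent, open on the isogenous `Y` -/

/-- **The isogeny door.** For `X : y² = x³ − 8x² + x` and the `ℚ`-isogenous `Y : y² = x(x − 6)(x + 4)`:
`X ~ Y`; `Ш(X/ℚ)[2] ≠ 0` (the complete `2`-descent on `X` does NOT close: `#Ш(X/ℚ)[φ] = 4`); `Ш(Y/ℚ)[2] = 0`
(the descent on `Y` is sharp); and nevertheless `t_2(X) = 0`. -/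
theorem door_closed_on_X_open_on_Y :
    IsIsogenous (⟨0, -8, 0, 1, 0⟩ : WeierstrassCurve ℚ) (⟨0, -2, 0, -24, 0⟩ : WeierstrassCurve ℚ) ∧
      (¬ ∀ c ∈ (⟨0, -8, 0, 1, 0⟩ : WeierstrassCurve ℚ).sha, 2 • c = 0 → c = 0) ∧
      (∀ c ∈ (⟨0, -2, 0, -24, 0⟩ : WeierstrassCurve ℚ).sha, 2 • c = 0 → c = 0) ∧
      (⟨0, -8, 0, 1, 0⟩ : WeierstrassCurve ℚ).shaCorank 2 = 0 :=
  ⟨isIsogenous_X_Y, not_forall_mem_sha_X_two_smul_eq_zero, forall_mem_sha_Y_two_smul_eq_zero, shaCorank_X_two⟩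

/-- **`Ш(X/ℚ)[2^∞]` is finite AND non-zero** (`t_2(X) = 0`, `#Ш(X/ℚ)[φ] = 4`): a finite non-trivial primary
component of a Tate–Shafarevich group, certified unconditionally; with `rank X(ℚ) = 0`. -/
theorem finite_nonzero_sha_two_primary_X [(⟨0, -8, 0, 1, 0⟩ : WeierstrassCurve ℚ).IsElliptic] :
    Finite (AddCommGroup.primaryComponent (⟨0, -8, 0, 1, 0⟩ : WeierstrassCurve ℚ).sha 2) ∧
      AddCommGroup.primaryComponent (⟨0, -8, 0, 1, 0⟩ : WeierstrassCurve ℚ).sha 2 ≠ ⊥ ∧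
      (⟨0, -8, 0, 1, 0⟩ : WeierstrassCurve ℚ).mordellWeilRank = 0 ∧
      Nat.card ↥((⟨0, -8, 0, 1, 0⟩ : WeierstrassCurve ℚ).sha ⊓
        (⟨0, -8, 0, 1, 0⟩ : WeierstrassCurve ℚ).twoIsogenyTorsorHom.range) = 4 :=
  ⟨finite_primaryComponent_sha_X_two, primaryComponent_sha_X_two_ne_bot, mordellWeilRank_X,
    natCard_sha_inf_range_eq_four⟩

/-! ## §2 Why T is stated with coranks: the finite-level readings fail -/

/-- **«`Ш(E)[p] ≠ 0 ⟹ t_p(E) > 0`» is FALSE**: the naive finite-level reading of the door (a non-closing first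
descent as evidence for an infinite `p`-primary part) is refuted by `X` at `p = 2`. -/
theorem not_sha_two_torsion_detects_corank :
    ¬ ∀ (W : WeierstrassCurve ℚ) [W.IsElliptic],
      (∃ c ∈ W.sha, c ≠ 0 ∧ 2 • c = 0) → W.shaCorank 2 ≠ 0 := by
  intro h
  haveI := isElliptic_X
  exact h _ exists_mem_sha_X_ne_zero_two_smul shaCorank_X_two

/-- **`Ш[2] = 0` is NOT an isogeny invariant, `t_2 = 0` IS**: the finite-level analogue along isogenies of T's
transport («`Ш(E')[p] = 0` for an isogenous `E'` ⟹ `Ш(E)[p] = 0`») fails at `(X, Y, 2)`, while the corank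
statement `t_2(X) = t_2(Y)` holds (tree theorem `IsIsogenous.shaCorank_eq`). [cite: Greenberg1999LNM, §1 pp. 54–57] -/
theorem sha_two_torsion_not_isogeny_invariant' :
    (¬ ∀ (W W' : WeierstrassCurve ℚ) [W.IsElliptic] [W'.IsElliptic], IsIsogenous W W' →
        (∀ c ∈ W'.sha, 2 • c = 0 → c = 0) → ∀ c ∈ W.sha, 2 • c = 0 → c = 0) ∧
      (⟨0, -8, 0, 1, 0⟩ : WeierstrassCurve ℚ).shaCorank 2 = (⟨0, -2, 0, -24, 0⟩ : WeierstrassCurve ℚ).shaCorank 2 := by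
  haveI := isElliptic_X
  haveI := isElliptic_Y
  haveI : Fact (Nat.Prime 2) := ⟨Nat.prime_two⟩
  refine ⟨fun h => ?_, isIsogenous_X_Y.shaCorank_eq 2⟩
  exact not_forall_mem_sha_X_two_smul_eq_zero (h _ _ isIsogenous_X_Y forall_mem_sha_Y_two_smul_eq_zero)

/-! ## §3 T and O on `X` -/

/-- **O's instance on `X` with witness prime `2`** — the door datum `t_2(X) = 0` is unconditional although
`Ш(X/ℚ)[2] ≠ 0`. -/
theorem oneFiniteShaComponent_X :
    ∃ (p : ℕ) (_ : Fact p.Prime), (⟨0, -8, 0, 1, 0⟩ : WeierstrassCurve ℚ).shaCorank p = 0 :=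
  ⟨2, ⟨Nat.prime_two⟩, shaCorank_X_two⟩

/-- **T predicts `t_q(X) = 0` for every prime `q`** (i.e. `Ш(X/ℚ)` finite, `X` having rank `0`), from the
unconditional `t_2(X) = 0`. CONDITIONAL on `hT`; unconditional for `q = 2` only. -/
theorem transfer_predicts_X (hT : FiniteShaComponentTransfer) (q : ℕ) [Fact q.Prime] :
    (⟨0, -8, 0, 1, 0⟩ : WeierstrassCurve ℚ).shaCorank q = 0 := by
  haveI := isElliptic_X
  haveI : Fact (Nat.Prime 2) := ⟨Nat.prime_two⟩
  exact hT _ 2 q shaCorank_X_two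

/-- **T's prediction in Selmer coordinates**: granting T, `corank_{ℤ_q} Sel_{q^∞}(X/ℚ) = 0 = rank X(ℚ)` at every
prime `q` (Greenberg's identity, tree theorem `selmerCorank_eq_mordellWeilRank_add_holds`). CONDITIONAL on `hT`. -/
theorem selmerCorank_X_of_transfer (hT : FiniteShaComponentTransfer) (q : ℕ) [Fact q.Prime] :
    (⟨0, -8, 0, 1, 0⟩ : WeierstrassCurve ℚ).selmerCorank q = 0 := by
  haveI := isElliptic_X
  rw [WeierstrassCurve.selmerCorank_eq_mordellWeilRank_add_holds, mordellWeilRank_X, transfer_predicts_X hT q]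

/-- **The Selmer column at `2`, unconditionally**: `corank_{ℤ₂} Sel_{2^∞}(X/ℚ) = 0 = rank X(ℚ)` although the
`φ`-Selmer group has `𝔽₂`-dimension `4` (`dim₂ S(16, 60) = 4`) — T's bookkeeping is the corank, which the finite
group `Ш(X/ℚ)[2^∞] ⊇ (ℤ/2ℤ)²` does not move. -/
theorem selmer_column_X :
    (⟨0, -8, 0, 1, 0⟩ : WeierstrassCurve ℚ).selmerCorank 2 = 0 ∧
      (⟨0, -8, 0, 1, 0⟩ : WeierstrassCurve ℚ).mordellWeilRank = 0 ∧ twoIsogenySelmerRank' (-8) 1 = 4 :=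
  ⟨selmerCorank_X_two, mordellWeilRank_X, twoIsogenySelmerRank'_X⟩

end Summit.BirchSwinnertonDyer.BirchSwinnertonDyer.Theorems.ShaPrimaryTransferIsogenyDoor

end
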